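import Summits.HodgeConjecture.HodgeConjecture.Theses.AnchorTransport
import Summits.HodgeConjecture.HodgeConjecture.Theorems.AnchorTransportTargetIffHodgeConjecture
import Summits.HodgeConjecture.HodgeConjecture.Theorems.AnchorTransportAnchorExistenceTransport
import Literature.AlgebraicGeometry.HodgeTheory.MotivatedClassesLefschetzRange
import Literature.AlgebraicGeometry.HodgeTheory.LefschetzOneOneHolds
import Literature.AlgebraicGeometry.HodgeTheory.HardLefschetzNFoldHolds
import Literature.AlgebraicGeometry.Surfaces.K3ComplexMultiplication
import Literature.AlgebraicGeometry.Motives.VarietiesDimensionProofs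
import HarnessLib

/-!
# Route AnchorTransport — `AnchorExistence` (item stmt-HodgeConjecture-1077): the typed split into its two sectors

The crux `AnchorExistence` (every rational `(p,p)`-class `c` on a smooth projective `X` of dimension
`n` is, up to an iso `X ≅ 𝒳_{s₁}`, the restriction of a fibrewise rational `(p,p)` class `A` on the
total space of a smooth projective family over a smooth irreducible base, algebraic on some fibre
`𝒳_{s₀}`) is concluded BY NAME from two sector statements, spelled out verbatim as hypotheses
(`anchorExistence_of_k3Square_of_offK3Square`):

* `hK3` — the **K3-square sector** at `p = 2`: every rational `(2,2)`-class on `S ⊗ S`, `S` a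
  projective K3 surface, is anchored;
* `hoff` — the **middle range off K3 squares**: for `2 ≤ p ≤ n − 2` and `X` not isomorphic to the
  square of a projective K3 surface, every rational `(p,p)`-class which is NOT already algebraic is
  anchored.

Everything else is the tree's theorems: in the Lefschetz range `p ≤ 1 ∨ n ≤ p + 1` the class is
algebraic on `X` itself (`mem_algebraicClasses_of_lefschetzRange` with the discharged Lefschetz
`(1,1)` theorem `lefschetzOneOne_rational_holds` and hard Lefschetz
`nonempty_hardLefschetzNFold_holds`), algebraic classes are anchored by the constant family
(`anchorTransport_anchor_of_mem_algebraicClasses`), anchor data transport along `X ≅ S ⊗ S`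
(`anchorTransport_anchor_map_of_iso`), and the dimension of a smooth projective scheme is an
isomorphism invariant (`anchorExistenceSplit_dim_eq_of_iso`, from `schemeDim_eq_holds`).

This is the kernel-checked composition of the lead skeleton `Cruxes/AnchorExistence/Lines/Sketch.lean`
(cycles 1–4) made importable, with its two open sectors as hypotheses: the glue a typed split of the
crux into `AnchorExistence|K3 squares` and `AnchorExistence|off K3 squares` consumes. The second
hypothesis is, by the landed `Negative/ConstantClause` and `anchorTransport_mem_algebraicClasses_of_anchor_of_fiberIso`,
the anchor GEOGRAPHY of the Hodge loci of non-algebraic Hodge classes (an anchor fibre not compatibly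
isomorphic to `X`), sandwiched with the Hodge conjecture there; the first is assembled from five
named facts and the real-multiplication construction in
`AnchorTransportAnchorExistenceK3SquareSector`.
-/

noncomputable section

set_option linter.dupNamespace false

open CategoryTheory AlgebraicGeometry MonoidalCategory
open Literature.AlgebraicGeometry Literature.AlgebraicGeometry.Motives
  Literature.AlgebraicGeometry.HodgeTheory Literature.AlgebraicGeometry.Surfaces

namespace Summit.HodgeConjecture.HodgeConjecture.Theorems

open Summit.HodgeConjecture.HodgeConjecture.Theses.AnchorTransport

/-- Two smooth projective `ℂ`-schemes that are isomorphic over `ℂ` have the same dimension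
(`schemeDim` is a homeomorphism invariant and equals the relative dimension,
`Motives.schemeDim_eq_holds`). [cite: Hartshorne1977, II Ex. 3.20 and III.10] -/
theorem anchorExistenceSplit_dim_eq_of_iso {n m : ℕ} {X Y : SchemeOver ℂ} (hX : IsSmoothProjective n X)
    (hY : IsSmoothProjective m Y) (g : X ≅ Y) : n = m := by
  have h₁ := schemeDim_eq_holds hX
  have h₂ := schemeDim_eq_holds hY
  unfold schemeDim at h₁ h₂
  have hdim : topologicalKrullDim ↥(X.left) = topologicalKrullDim ↥(Y.left) :=
    IsHomeomorph.topologicalKrullDim_eq _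
      (TopCat.homeoOfIso (Scheme.forgetToTop.mapIso ((Over.forget _).mapIso g))).isHomeomorph
  rw [hdim] at h₁
  exact h₁.symm.trans h₂

/-- **`AnchorExistence` from its two sectors** (typed split of the crux, kernel-checked glue). Given
(`hK3`) that every rational `(2,2)`-class on the square `S ⊗ S` of a projective K3 surface is anchored,
and (`hoff`) that in the middle range `2 ≤ p ≤ n − 2`, off K3 squares, every rational `(p,p)`-class
which is not already algebraic is anchored, the crux `AnchorExistence` follows: Lefschetz range by
Lefschetz `(1,1)` + hard Lefschetz and the constant family; a K3 square `X ≅ S ⊗ S` has `n = 4`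
(`anchorExistenceSplit_dim_eq_of_iso`), so `p = 2`, and the anchor of `(S ⊗ S, (g⁻¹)^* c)` transports
along `g`; off K3 squares, algebraic classes take the constant family and the rest is `hoff`. The
conclusion is literally the route decl. [cite: Deligne2000, §1] [cite: VoisinHodgeI2002, Thm. 11.30 and Thm. 6.25] -/
theorem anchorExistence_of_k3Square_of_offK3Square :
    (∀ S : SchemeOver ℂ, IsK3Surface S →
      ∀ c : complexBetti (S ⊗ S) (2 * 2), IsRationalClass c → IsOfHodgeType 4 (S ⊗ S) (2 * 2) 2 2 c →
      ∃ (𝒳 B : SchemeOver ℂ) (f : 𝒳 ⟶ B) (s₁ s₀ : ComplexPoints B) (e : S ⊗ S ≅ fiberOver f s₁)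
        (A : complexBetti 𝒳 (2 * 2)),
        IsSmoothProjectiveFamily f 4 ∧ IrreducibleSpace B.left ∧ AlgebraicGeometry.Smooth B.hom ∧
        (∀ s : ComplexPoints B, IsRationalClass (complexBetti.map (fiberι f s) (2 * 2) A) ∧
          IsOfHodgeType 4 (fiberOver f s) (2 * 2) 2 2 (complexBetti.map (fiberι f s) (2 * 2) A)) ∧
        complexBetti.map e.hom (2 * 2) (complexBetti.map (fiberι f s₁) (2 * 2) A) = c ∧
        complexBetti.map (fiberι f s₀) (2 * 2) A ∈ algebraicClasses (fiberOver f s₀) 2) →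
    (∀ ⦃n : ℕ⦄ ⦃X : SchemeOver ℂ⦄, IsSmoothProjective n X →
      (∀ S : SchemeOver ℂ, IsK3Surface S → IsEmpty (X ≅ S ⊗ S)) →
      ∀ (p : ℕ), 2 ≤ p → p + 2 ≤ n →
      ∀ (c : complexBetti X (2 * p)), IsRationalClass c → IsOfHodgeType n X (2 * p) p p c →
      c ∉ algebraicClasses X p →
      ∃ (𝒳 S : SchemeOver ℂ) (f : 𝒳 ⟶ S) (s₁ s₀ : ComplexPoints S) (e : X ≅ fiberOver f s₁)
        (A : complexBetti 𝒳 (2 * p)),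
        IsSmoothProjectiveFamily f n ∧ IrreducibleSpace S.left ∧ AlgebraicGeometry.Smooth S.hom ∧
        (∀ s : ComplexPoints S, IsRationalClass (complexBetti.map (fiberι f s) (2 * p) A) ∧
          IsOfHodgeType n (fiberOver f s) (2 * p) p p (complexBetti.map (fiberι f s) (2 * p) A)) ∧
        complexBetti.map e.hom (2 * p) (complexBetti.map (fiberι f s₁) (2 * p) A) = c ∧
        complexBetti.map (fiberι f s₀) (2 * p) A ∈ algebraicClasses (fiberOver f s₀) p) →
    AnchorExistence := by
  intro hK3 hoff
  unfold AnchorExistence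
  intro n X hX p c hc hpp
  by_cases hrange : p ≤ 1 ∨ n ≤ p + 1
  · -- Lefschetz range: `c` is algebraic on `X`; constant family
    exact anchorTransport_anchor_of_mem_algebraicClasses hX p c hc hpp
      (mem_algebraicClasses_of_lefschetzRange lefschetzOneOne_rational_holds
        (nonempty_hardLefschetzNFold_holds n X) hX hrange c hc hpp)
  have hp2 : 2 ≤ p := by omega
  have hpn : p + 2 ≤ n := by omega
  by_cases hK3X : ∃ S : SchemeOver ℂ, IsK3Surface S ∧ Nonempty (X ≅ S ⊗ S)
  · -- K3 square: `n = 4`, `p = 2`; anchor `(S ⊗ S, (g⁻¹)^* c)` and transport along `g`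
    obtain ⟨S, hS, ⟨g⟩⟩ := hK3X
    have hSS : IsSmoothProjective 4 (S ⊗ S) := hS.isSmoothProjective_tensor_self
    obtain rfl : n = 4 := anchorExistenceSplit_dim_eq_of_iso hX hSS g
    obtain rfl : p = 2 := by omega
    have h := hK3 S hS (complexBetti.map g.inv (2 * 2) c) (hc.map _) (hpp.map_of_iso g.symm)
    have h' := anchorTransport_anchor_map_of_iso (n := 4) g h
    have hid : complexBetti.map g.hom (2 * 2) (complexBetti.map g.inv (2 * 2) c) = c := by
      change (complexBetti.map g.inv (2 * 2) ≫ complexBetti.map g.hom (2 * 2)) c = c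
      rw [← complexBetti.map_comp, Iso.hom_inv_id, complexBetti.map_id]
      rfl
    rwa [hid] at h'
  · -- off K3 squares: algebraic classes by the constant family, the rest is `hoff`
    by_cases halg : c ∈ algebraicClasses X p
    · exact anchorTransport_anchor_of_mem_algebraicClasses hX p c hc hpp halg
    have hK3' : ∀ S : SchemeOver ℂ, IsK3Surface S → IsEmpty (X ≅ S ⊗ S) := fun S hS =>
      ⟨fun g => hK3X ⟨S, hS, ⟨g⟩⟩⟩
    exact hoff hX hK3' p hp2 hpn c hc hpp halg

/-- **The typed split is lossless** (lead c4, 2026-08-17): `AnchorExistence` is EQUIVALENT to the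
conjunction of its two sectors. The K3-square sector is the instance `X = S ⊗ S`, `n = 4`, `p = 2` of
the crux (a K3 square is smooth projective of dimension `4`, `IsK3Surface.isSmoothProjective_tensor_self`);
the off-K3-square complement is the instance of the crux with its three extra hypotheses (not a K3
square, middle range, `c` not already algebraic) forgotten; the converse is the glue
`anchorExistence_of_k3Square_of_offK3Square`. Hence splitting the crux into these two children
neither weakens nor strengthens it: the children are jointly equivalent to the parent, and the second
child alone carries everything the crux asserts beyond K3 squares, the Lefschetz range and the
already-algebraic classes. [cite: Deligne2000, §1] [cite: VoisinHodgeI2002, Thm. 11.30 and Thm. 6.25] -/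
theorem anchorExistence_iff_k3Square_and_offK3Square :
    AnchorExistence ↔
      ((∀ S : SchemeOver ℂ, IsK3Surface S →
        ∀ c : complexBetti (S ⊗ S) (2 * 2), IsRationalClass c → IsOfHodgeType 4 (S ⊗ S) (2 * 2) 2 2 c →
        ∃ (𝒳 B : SchemeOver ℂ) (f : 𝒳 ⟶ B) (s₁ s₀ : ComplexPoints B) (e : S ⊗ S ≅ fiberOver f s₁)
          (A : complexBetti 𝒳 (2 * 2)),
          IsSmoothProjectiveFamily f 4 ∧ IrreducibleSpace B.left ∧ AlgebraicGeometry.Smooth B.hom ∧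
          (∀ s : ComplexPoints B, IsRationalClass (complexBetti.map (fiberι f s) (2 * 2) A) ∧
            IsOfHodgeType 4 (fiberOver f s) (2 * 2) 2 2 (complexBetti.map (fiberι f s) (2 * 2) A)) ∧
          complexBetti.map e.hom (2 * 2) (complexBetti.map (fiberι f s₁) (2 * 2) A) = c ∧
          complexBetti.map (fiberι f s₀) (2 * 2) A ∈ algebraicClasses (fiberOver f s₀) 2) ∧
      (∀ ⦃n : ℕ⦄ ⦃X : SchemeOver ℂ⦄, IsSmoothProjective n X →
        (∀ S : SchemeOver ℂ, IsK3Surface S → IsEmpty (X ≅ S ⊗ S)) →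
        ∀ (p : ℕ), 2 ≤ p → p + 2 ≤ n →
        ∀ (c : complexBetti X (2 * p)), IsRationalClass c → IsOfHodgeType n X (2 * p) p p c →
        c ∉ algebraicClasses X p →
        ∃ (𝒳 S : SchemeOver ℂ) (f : 𝒳 ⟶ S) (s₁ s₀ : ComplexPoints S) (e : X ≅ fiberOver f s₁)
          (A : complexBetti 𝒳 (2 * p)),
          IsSmoothProjectiveFamily f n ∧ IrreducibleSpace S.left ∧ AlgebraicGeometry.Smooth S.hom ∧
          (∀ s : ComplexPoints S, IsRationalClass (complexBetti.map (fiberι f s) (2 * p) A) ∧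
            IsOfHodgeType n (fiberOver f s) (2 * p) p p (complexBetti.map (fiberι f s) (2 * p) A)) ∧
          complexBetti.map e.hom (2 * p) (complexBetti.map (fiberι f s₁) (2 * p) A) = c ∧
          complexBetti.map (fiberι f s₀) (2 * p) A ∈ algebraicClasses (fiberOver f s₀) p)) := by
  refine ⟨fun h => ⟨fun S hS c hc hpp => ?_, fun _ _ hX _ p _ _ c hc hpp _ => ?_⟩,
    fun h => anchorExistence_of_k3Square_of_offK3Square h.1 h.2⟩
  · -- the K3-square sector is the instance `n = 4`, `X = S ⊗ S`, `p = 2` of the crux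
    exact h hS.isSmoothProjective_tensor_self 2 c hc hpp
  · -- the complement is the crux with its extra hypotheses forgotten
    exact h hX p c hc hpp

end Summit.HodgeConjecture.HodgeConjecture.Theorems

end
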